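import Summits.NavierStokesRegularity.NavierStokesRegularity.Theorems.StrainDoorsNearRecordGradientDeficit
import HarnessLib

/-!
# StrainDoorsNearRecordGradientRate — PART M §M7: THE NEAR-RECORD GRADIENT LAW WITH A RATE

(Tree file 2 of 2 of PART M (§M6a/§M7/§M10, ROUND 63 text A); text of nsreg-p1 r63/StrainDoorsNearRecordGradientRate.lean sha256 da07e244be2a3583, split at the 400-line cap at § boundaries,
bodies verbatim; imports file 1 `StrainDoorsNearRecordGradientDeficit`.)

nsreg-p1 g36, ROUND-63 (helper lane of `stmt-NavierStokesRegularity-0056`, rung N0; 0 ledger writes by the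
planner — text for the S-lane to land `--supports stmt-NavierStokesRegularity-0056 --as helper`; tree file 1 of 5
of ROUND-63; bodies farm-certified inside `r63/StrainDoorsR63All.lean`, rc 0 · 0 warn · 0 sorry, std axioms).

ROUNDS 60–62 produced NECESSARY LAWS at near-record points of classical Type-I ancient solutions by compactness
(extraction of a Type-I tangent peak + transfer): a `δ(C₀,w₀,ε) > 0` EXISTS.  This file shows that the FIRST-ORDER
law is QUANTITATIVE and needs no blow-up sequence at all: rescale the near-record point to time `−1`; the function
`f = |ω'(−1,·)|²` is bounded by `W²`, is within `2Wδ` of `W²` at the point, and has an `L(C₀)`-Lipschitz gradient by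
the uniform `C^{2,1}` bounds of the Type-I class (PART H, PART M §M1); the one-sided Taylor estimate
`f(z + h) ≥ f(z) + ∇f(z)·h − L|h|²` at a near-maximum then forces `|∇f(z)| ≤ 2√((W² − f(z)) L)` (Fermat with a rate).

* `fderiv_norm_curl_nsRescale`, `gradNormNumber_nsRescale` — the parabolic scale law of `∇|ω|`
  (`(0 − t)^{3/2}‖∇|ω|(t,x)‖` is scale-invariant);
* `linear_le_two_sqrt_of_forall_quadratic`, `norm_fderiv_le_two_sqrt_of_le` — Fermat at a near-maximum WITH A
  RATE for a function with Lipschitz gradient;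
* ★★★ `typeI_vorticityModulus_gradient_deficit` — THE DEFICIT LAW: there is `A = A(C₀)` with
  `((0 − t)|ω(t,x)|)·((0 − t)^{3/2}‖∇|ω|(t,x)‖) ≤ √(A·W·δ)` whenever `(0 − t)|ω(t,·)| ≤ W` AT THAT INSTANT and
  `(0 − t)|ω(t,x)| ≥ W − δ` — compactness-free, uniform in the class, with the explicit rate `√δ`;
* ★★ `typeI_nearRecord_gradient_rate` — `(0 − t)^{3/2}‖∇|ω|(t,x)‖ ≤ A(C₀,w₀)·√δ` for `W ≥ w₀`, `δ ≤ w₀/2`;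
* `typeI_nearRecord_gradient_pinch` — the qualitative `ε`–`δ` pinch with the explicit `δ = min(w₀/2, (ε/(A+1))²)`;
* §M10 THE SET STRUCTURE OF NEAR-RECORDS (answers ref3 R62-R1: a SET statement with an explicit class constant,
  separate from the pointwise laws): ★ `typeI_vorticityNumber_spatial_transfer` — `(0 − t)|ω(t,x)| ≤
  (0 − t)|ω(t,y)| + K(C₀)·|y − x|/√(0 − t)` (the vorticity number is `K`-Lipschitz in the parabolic variable);
  ★ `typeI_vorticityNumber_temporal_transfer` — `(0 − t)|ω(t,x)| ≤ (0 − s)|ω(s,x)| + K(C₀)·(t − s)/(0 − t)` for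
  `2t ≤ s ≤ t`; hence a `δ`-near-record at `(t,x)` makes the whole parabolic cylinder of radius `r√(0 − t)` a set of
  `(δ + Kr)`-near-records, and ★★ `typeI_nearRecord_gradient_rate_ball` — the gradient law holds ON THE BALL:
  `(0 − t)^{3/2}‖∇|ω|(t,y)‖ ≤ A√(δ + K r)` for `|y − x| ≤ r√(0 − t)`, `δ + K r ≤ w₀/2`.

WHAT THIS IS NOT: necessary conditions at near-record points; nothing here excludes a blow-up; `0056` / `10661` /
NS regularity are NOT proved; the peak doors of PART K stay OPEN.  No new definitions; no sorry.
[cite: KochNadirashviliSereginSverak2009, §2 p. 5, (4.11); ChaeWolf2017RemovingDSS, §3 Step 2;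
ConstantinFefferman1993, §1]
-/

noncomputable section

open MeasureTheory Set Function Filter Metric Real InnerProductSpace
open _root_.Topology
open scoped ENNReal NNReal RealInnerProductSpace ContDiff Laplacian
open Literature.Analysis Literature.Analysis.FluidPDE
open Literature.Analysis.FluidPDE.VorticityDirectionDynamics

set_option linter.dupNamespace false
set_option maxSynthPendingDepth 3

namespace Summit.NavierStokesRegularity.NavierStokesRegularity.Theorems.StrainDoors

open Summit.NavierStokesRegularity.NavierStokesRegularity.Theorems.ArgmaxDoors

/-! ## §M10 Near-record points come in parabolic cylinders (ROUND 63): the SET structure, explicit constants -/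

/-- ★ **Spatial transfer of the vorticity number.**  For every `C₀ ≥ 0` there is `K = K(C₀) ≥ 0` (the
scale-invariant Lipschitz constant of the vorticity in the Type-I class, `K = ‖curl‖·K₂` with `K₂` of
`exists_uniform_gradLipschitz`) such that for every classical Type-I solution, every `t < 0` and all `x, y`:
`(0 − t)|ω(t,x)| ≤ (0 − t)|ω(t,y)| + K·|y − x|/√(0 − t)`.  Hence a `δ`-near-record point `(t,x)` carries the
parabolic ball `{y : |y − x| ≤ r√(0 − t)}` of `(δ + K r)`-near-record points — the SET statement, separate
from the laws (ref3 R62-R1). [new-as-typed; folklore mechanism] -/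
theorem typeI_vorticityNumber_spatial_transfer {C₀ : ℝ} (hC₀ : 0 ≤ C₀) :
    ∃ K : ℝ, 0 ≤ K ∧ ∀ (u : ℝ → (EuclideanSpace ℝ (Fin 3)) → (EuclideanSpace ℝ (Fin 3)))
      (p : ℝ → (EuclideanSpace ℝ (Fin 3)) → ℝ) (t : ℝ) (x y : EuclideanSpace ℝ (Fin 3)),
        IsClassicalNSSolutionOn (Iio 0) 1 0 u p → HasTypeIDecay C₀ u → t < 0 →
        (0 - t) * ‖curl (u t) x‖ ≤ (0 - t) * ‖curl (u t) y‖ + K * (‖y - x‖ / √(0 - t)) := by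
  obtain ⟨K₂, L₁, hK₂, hL₁, hG⟩ := exists_uniform_gradLipschitz hC₀
  obtain ⟨c, hc⟩ : ∃ c : ℝ, c = ‖(curlCLM : ((EuclideanSpace ℝ (Fin 3)) →L[ℝ] (EuclideanSpace ℝ (Fin 3))) →L[ℝ]
      (EuclideanSpace ℝ (Fin 3)))‖ := ⟨_, rfl⟩
  have hc0 : 0 ≤ c := by rw [hc]; exact norm_nonneg _
  refine ⟨c * K₂, by positivity, fun u p t x y hsol hI ht => ?_⟩
  -- rescale to time `-1`
  obtain ⟨lam, hlam⟩ : ∃ lam : ℝ, lam = √(0 - t) := ⟨_, rfl⟩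
  have hlam0 : 0 < lam := by rw [hlam]; exact Real.sqrt_pos.mpr (by linarith)
  have hlam2 : lam ^ 2 = 0 - t := by rw [hlam]; exact Real.sq_sqrt (by linarith)
  have ht1 : lam ^ 2 * (-1) = t := by rw [hlam2]; ring
  obtain ⟨z, hz⟩ : ∃ z : EuclideanSpace ℝ (Fin 3), z = lam⁻¹ • x := ⟨_, rfl⟩
  have hxz : lam • z = x := by rw [hz]; exact smul_inv_smul₀ hlam0.ne' _
  obtain ⟨z', hz'⟩ : ∃ z' : EuclideanSpace ℝ (Fin 3), z' = lam⁻¹ • y := ⟨_, rfl⟩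
  have hyz : lam • z' = y := by rw [hz']; exact smul_inv_smul₀ hlam0.ne' _
  have hcl := (typeI_class_nsRescale hlam0 hsol hI).1
  have hI' := (typeI_class_nsRescale hlam0 hsol hI).2
  -- Lipschitz bound of the rescaled vorticity at time `-1`
  have hlip := curl_sub_le_of_fderiv_lipschitz ((hG hcl hI').1 (-1) (by norm_num)) z z'
  rw [← hc] at hlip
  have hzz : ‖z - z'‖ = ‖y - x‖ / √(0 - t) := by
    rw [← hlam, hz, hz', ← smul_sub, norm_smul, norm_inv, Real.norm_of_nonneg hlam0.le, norm_sub_rev]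
    field_simp
  -- back to `u`
  have ex : (0 - t) * ‖curl (u t) x‖ = (0 - (-1)) * ‖curl (nsRescale lam u (-1)) z‖ := by
    conv_lhs => rw [← hxz, ← ht1]
    rw [← vorticityNumber_nsRescale]
  have ey : (0 - t) * ‖curl (u t) y‖ = (0 - (-1)) * ‖curl (nsRescale lam u (-1)) z'‖ := by
    conv_lhs => rw [← hyz, ← ht1]
    rw [← vorticityNumber_nsRescale]
  rw [ex, ey, ← hzz]
  have hn := norm_sub_norm_le (curl (nsRescale lam u (-1)) z) (curl (nsRescale lam u (-1)) z')
  norm_num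
  nlinarith [hn, hlip]

/-- ★ **Temporal transfer of the vorticity number.**  For every `C₀ ≥ 0` there is `K = K(C₀) ≥ 0`
(`K = 2‖curl‖·L₁ + B`: `L₁` the scale-invariant time-Lipschitz constant of `∇u` of `exists_uniform_gradLipschitz`,
`B` the bound of the vorticity number of `typeI_vorticityNumber_bound`) such that for every classical Type-I
solution, every point `x` and all times `2t ≤ s ≤ t < 0` (one parabolic unit into the past):
`(0 − t)|ω(t,x)| ≤ (0 − s)|ω(s,x)| + K·(t − s)/(0 − t)`.  Hence a `δ`-near-record point `(t,x)` carries the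
backward parabolic interval `[t − h(0 − t), t] × {x}` of `(δ + K h)`-near-record points; with the spatial
transfer, a whole backward parabolic cylinder. [new-as-typed; folklore mechanism] -/
theorem typeI_vorticityNumber_temporal_transfer {C₀ : ℝ} (hC₀ : 0 ≤ C₀) :
    ∃ K : ℝ, 0 ≤ K ∧ ∀ (u : ℝ → (EuclideanSpace ℝ (Fin 3)) → (EuclideanSpace ℝ (Fin 3)))
      (p : ℝ → (EuclideanSpace ℝ (Fin 3)) → ℝ) (t s : ℝ) (x : EuclideanSpace ℝ (Fin 3)),
        IsClassicalNSSolutionOn (Iio 0) 1 0 u p → HasTypeIDecay C₀ u → t < 0 → s ≤ t → 2 * t ≤ s →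
        (0 - t) * ‖curl (u t) x‖ ≤ (0 - s) * ‖curl (u s) x‖ + K * ((t - s) / (0 - t)) := by
  obtain ⟨B, hB, hBb⟩ := typeI_vorticityNumber_bound hC₀
  obtain ⟨K₂, L₁, hK₂, hL₁, hG⟩ := exists_uniform_gradLipschitz hC₀
  obtain ⟨c, hc⟩ : ∃ c : ℝ, c = ‖(curlCLM : ((EuclideanSpace ℝ (Fin 3)) →L[ℝ] (EuclideanSpace ℝ (Fin 3))) →L[ℝ]
      (EuclideanSpace ℝ (Fin 3)))‖ := ⟨_, rfl⟩
  have hc0 : 0 ≤ c := by rw [hc]; exact norm_nonneg _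
  refine ⟨2 * (c * L₁) + B, by positivity, fun u p t s x hsol hI ht hst h2t => ?_⟩
  -- rescale to time `-1`
  obtain ⟨lam, hlam⟩ : ∃ lam : ℝ, lam = √(0 - t) := ⟨_, rfl⟩
  have hlam0 : 0 < lam := by rw [hlam]; exact Real.sqrt_pos.mpr (by linarith)
  have hlam2 : lam ^ 2 = 0 - t := by rw [hlam]; exact Real.sq_sqrt (by linarith)
  have ht1 : lam ^ 2 * (-1) = t := by rw [hlam2]; ring
  obtain ⟨z, hz⟩ : ∃ z : EuclideanSpace ℝ (Fin 3), z = lam⁻¹ • x := ⟨_, rfl⟩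
  have hxz : lam • z = x := by rw [hz]; exact smul_inv_smul₀ hlam0.ne' _
  obtain ⟨s', hs'⟩ : ∃ s' : ℝ, s' = s / lam ^ 2 := ⟨_, rfl⟩
  have hl2 : 0 < lam ^ 2 := by positivity
  have hs1 : lam ^ 2 * s' = s := by rw [hs']; field_simp
  have hs'le : s' ≤ -1 := by
    rw [hs', div_le_iff₀ hl2]; linarith
  have hs'ge : -2 ≤ s' := by
    rw [hs', le_div_iff₀ hl2]; linarith
  have ht0 : (0 - t) ≠ 0 := by linarith
  have htne : t ≠ 0 := ht.ne
  have hs'eq : s' + 1 = -((t - s) / (0 - t)) := by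
    rw [hs', hlam2]; field_simp; ring
  have hcl := (typeI_class_nsRescale hlam0 hsol hI).1
  have hI' := (typeI_class_nsRescale hlam0 hsol hI).2
  -- time-Lipschitz bound of the rescaled vorticity at the frozen point `z`, between `s'` and `-1`
  have hlipD := (hG hcl hI').2 s' (by linarith) (-1) (by norm_num) z
  have hlip : ‖curl (nsRescale lam u (-1)) z - curl (nsRescale lam u s') z‖ ≤ c * L₁ * |(-1 : ℝ) - s'| := by
    rw [curl_eq_curlCLM, curl_eq_curlCLM, ← map_sub, hc]
    exact (ContinuousLinearMap.le_opNorm _ _).trans (by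
      rw [mul_assoc]; exact mul_le_mul_of_nonneg_left hlipD (norm_nonneg _))
  have habs : |(-1 : ℝ) - s'| = (t - s) / (0 - t) := by
    rw [show (-1 : ℝ) - s' = -(s' + 1) by ring, abs_neg, hs'eq, abs_neg,
      abs_of_nonneg (div_nonneg (by linarith) (by linarith))]
  have hwB : ‖curl (nsRescale lam u (-1)) z‖ ≤ B := by
    have h := hBb hcl hI' (-1) (by norm_num) z
    norm_num at h
    exact h
  -- back to `u`
  have ex : (0 - t) * ‖curl (u t) x‖ = (0 - (-1)) * ‖curl (nsRescale lam u (-1)) z‖ := by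
    conv_lhs => rw [← hxz, ← ht1]
    rw [← vorticityNumber_nsRescale]
  have es : (0 - s) * ‖curl (u s) x‖ = (0 - s') * ‖curl (nsRescale lam u s') z‖ := by
    conv_lhs => rw [← hxz, ← hs1]
    rw [← vorticityNumber_nsRescale]
  rw [ex, es]
  have hn := norm_sub_norm_le (curl (nsRescale lam u (-1)) z) (curl (nsRescale lam u s') z)
  rw [habs] at hlip
  have hq : 0 ≤ (t - s) / (0 - t) := div_nonneg (by linarith) (by linarith)
  have hq1 : (t - s) / (0 - t) ≤ 1 := by rw [div_le_one (by linarith)]; linarith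
  -- (0 - (-1))‖ω'(-1)‖ − (0 − s')‖ω'(s')‖ = (‖ω'(-1)‖ − ‖ω'(s')‖)·(0 − s') + (s' + 1)‖ω'(-1)‖ hmm: direct estimate
  have h1 : (0 - (-1 : ℝ)) * ‖curl (nsRescale lam u (-1)) z‖ - (0 - s') * ‖curl (nsRescale lam u s') z‖
      = (0 - s') * (‖curl (nsRescale lam u (-1)) z‖ - ‖curl (nsRescale lam u s') z‖)
        + (s' + 1) * ‖curl (nsRescale lam u (-1)) z‖ := by ring
  have h2 : (0 - s') * (‖curl (nsRescale lam u (-1)) z‖ - ‖curl (nsRescale lam u s') z‖)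
      ≤ 2 * (c * L₁ * ((t - s) / (0 - t))) :=
    (mul_le_mul_of_nonneg_left (hn.trans hlip) (by linarith)).trans
      (mul_le_mul_of_nonneg_right (by linarith) (by positivity))
  have h3 : (s' + 1) * ‖curl (nsRescale lam u (-1)) z‖ ≤ 0 :=
    mul_nonpos_of_nonpos_of_nonneg (by linarith) (norm_nonneg _)
  nlinarith [h1, h2, h3, hwB, hq, hB]

/-- ★★ **The gradient law on parabolic balls** (the set law = spatial transfer ∘ pointwise law).  For all
`C₀ ≥ 0`, `w₀ > 0` there are `A, K ≥ 0` such that at every `δ`-near-record point `(t,x)` of a classical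
Type-I solution (vorticity number `≤ W` at the instant `t`, `W ≥ w₀`) and every radius `r ≥ 0` with
`δ + K r ≤ w₀/2`, the scale-invariant vorticity-modulus gradient obeys
`(0 − t)^{3/2}‖∇|ω|(t,y)‖ ≤ A·√(δ + K r)` for ALL `y` with `|y − x| ≤ r√(0 − t)`. [new-as-typed] -/
theorem typeI_nearRecord_gradient_rate_ball {C₀ w₀ : ℝ} (hC₀ : 0 ≤ C₀) (hw₀ : 0 < w₀) :
    ∃ A K : ℝ, 0 ≤ A ∧ 0 ≤ K ∧ ∀ (u : ℝ → (EuclideanSpace ℝ (Fin 3)) → (EuclideanSpace ℝ (Fin 3)))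
      (p : ℝ → (EuclideanSpace ℝ (Fin 3)) → ℝ) (W t δ r : ℝ) (x y : EuclideanSpace ℝ (Fin 3)),
        IsClassicalNSSolutionOn (Iio 0) 1 0 u p → HasTypeIDecay C₀ u → t < 0 →
        (∀ y, (0 - t) * ‖curl (u t) y‖ ≤ W) → w₀ ≤ W → 0 ≤ δ → 0 ≤ r → δ + K * r ≤ w₀ / 2 →
        W - δ ≤ (0 - t) * ‖curl (u t) x‖ → ‖y - x‖ ≤ r * √(0 - t) →
        (0 - t) * √(0 - t) * ‖fderiv ℝ (fun y => ‖curl (u t) y‖) y‖ ≤ A * √(δ + K * r) := by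
  obtain ⟨A, hA, hlaw⟩ := typeI_nearRecord_gradient_rate hC₀ hw₀
  obtain ⟨K, hK, htr⟩ := typeI_vorticityNumber_spatial_transfer hC₀
  refine ⟨A, K, hA, hK, fun u p W t δ r x y hsol hI ht hdom hW hδ hr hKr hnear hyx => ?_⟩
  have hst : 0 < √(0 - t) := Real.sqrt_pos.mpr (by linarith)
  have h1 := htr u p t x y hsol hI ht
  have h2 : K * (‖y - x‖ / √(0 - t)) ≤ K * r :=
    mul_le_mul_of_nonneg_left (by rw [div_le_iff₀ hst]; exact hyx) hK
  exact hlaw u p W t (δ + K * r) y hsol hI ht hdom hW (by positivity) hKr (by linarith)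

end Summit.NavierStokesRegularity.NavierStokesRegularity.Theorems.StrainDoors

end
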